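import Mathlib
import Literature.Analysis.FluidPDE.CoordDerivatives
import HarnessLib

/-!
# `SlicedKelvin.FoldLawEps` — tools I: calculus on a coordinate plane (item
  stmt-NavierStokesRegularity-15606, part 1 of 3)

Elementary tools for integrals over the coordinate plane `Π_c = {x₂ = c} ⊂ ℝ³`, parametrised by
`P_c(y) = (y₀, y₁, c)`, `y ∈ ℝ²`:

* `FoldLaw.hasFDerivAt_plane`, `FoldLaw.pderiv_comp_plane` — `P_c` is affine with derivative the
  embedding `ℝ² ↪ ℝ³`, so the in-plane partial derivatives `∂₀, ∂₁` of `g` at `P_c y` are the partial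
  derivatives of `g ∘ P_c` at `y`;
* `FoldLaw.integral_plane_mul_pderiv` — **integration by parts on the plane** in the directions
  `i = 0, 1`: `∫ a ∂ᵢb = −∫ ∂ᵢa b` over `Π_c` (Mathlib's
  `integral_mul_fderiv_eq_neg_fderiv_mul_of_integrable` on `ℝ²`);
* `FoldLaw.integrable_plane_of_decay` — a continuous function with `|h(x)| ≤ K (1 + ‖x‖)⁻³` is
  integrable over every coordinate plane (`‖y‖ ≤ ‖P_c y‖`, Mathlib's `integrable_one_add_norm`);
* pointwise bookkeeping for products of bounded and decaying factors.

HONEST FRAMING: multivariable calculus; nothing here bears on the regularity problem itself.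
-/

noncomputable section

set_option linter.dupNamespace false

namespace Summit.NavierStokesRegularity.NavierStokesRegularity.Theorems

open MeasureTheory Set Filter Topology Metric Function Literature.Analysis.FluidPDE
open scoped NNReal ENNReal ContDiff

namespace FoldLaw

/-! ### The plane map `P_c(y) = (y₀, y₁, c)` -/

/-- The linear part of the plane map: `y ↦ (y₀, y₁, 0)`, as a continuous linear map. [folklore] -/
theorem exists_planeCLM :
    ∃ L : EuclideanSpace ℝ (Fin 2) →L[ℝ] EuclideanSpace ℝ (Fin 3),
      (∀ y : EuclideanSpace ℝ (Fin 2), L y = WithLp.toLp 2 ![y 0, y 1, 0]) ∧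
      (∀ i : Fin 2, L (EuclideanSpace.single i 1) = EuclideanSpace.single (Fin.castSucc i) 1) := by
  set L : EuclideanSpace ℝ (Fin 2) →L[ℝ] EuclideanSpace ℝ (Fin 3) :=
    (EuclideanSpace.proj (0 : Fin 2) : EuclideanSpace ℝ (Fin 2) →L[ℝ] ℝ).smulRight
        (EuclideanSpace.single (0 : Fin 3) (1 : ℝ)) +
      (EuclideanSpace.proj (1 : Fin 2) : EuclideanSpace ℝ (Fin 2) →L[ℝ] ℝ).smulRight
        (EuclideanSpace.single (1 : Fin 3) (1 : ℝ)) with hL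
  have hLy : ∀ y : EuclideanSpace ℝ (Fin 2), L y = WithLp.toLp 2 ![y 0, y 1, 0] := by
    intro y
    ext j
    fin_cases j <;> simp [hL]
  refine ⟨L, hLy, fun i => ?_⟩
  rw [hLy]
  ext j
  fin_cases i <;> fin_cases j <;> simp

/-- **The plane map is affine**: `P_c` has derivative `L` (the embedding `ℝ² ↪ ℝ³`) everywhere.
[folklore] -/
theorem hasFDerivAt_plane (c : ℝ) {L : EuclideanSpace ℝ (Fin 2) →L[ℝ] EuclideanSpace ℝ (Fin 3)}
    (hL : ∀ y : EuclideanSpace ℝ (Fin 2), L y = WithLp.toLp 2 ![y 0, y 1, 0])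
    (y : EuclideanSpace ℝ (Fin 2)) :
    HasFDerivAt (fun y : EuclideanSpace ℝ (Fin 2) => (WithLp.toLp 2 ![y 0, y 1, c] : EuclideanSpace ℝ (Fin 3)))
      L y := by
  have hP : (fun y : EuclideanSpace ℝ (Fin 2) => (WithLp.toLp 2 ![y 0, y 1, c] : EuclideanSpace ℝ (Fin 3))) =
      fun y => L y + WithLp.toLp 2 ![0, 0, c] := by
    funext y
    rw [hL]
    ext j
    fin_cases j <;> simp
  rw [hP]
  exact L.hasFDerivAt.add_const _

/-- The plane map is continuous. [folklore] -/
theorem continuous_plane (c : ℝ) :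
    Continuous fun y : EuclideanSpace ℝ (Fin 2) =>
      (WithLp.toLp 2 ![y 0, y 1, c] : EuclideanSpace ℝ (Fin 3)) := by
  obtain ⟨L, hL, -⟩ := exists_planeCLM
  exact continuous_iff_continuousAt.2 fun y => (hasFDerivAt_plane c hL y).continuousAt

/-- `‖y‖ ≤ ‖P_c y‖`. [folklore] -/
theorem norm_le_norm_plane (c : ℝ) (y : EuclideanSpace ℝ (Fin 2)) :
    ‖y‖ ≤ ‖(WithLp.toLp 2 ![y 0, y 1, c] : EuclideanSpace ℝ (Fin 3))‖ := by
  rw [EuclideanSpace.norm_eq, EuclideanSpace.norm_eq]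
  refine Real.sqrt_le_sqrt ?_
  simp only [Fin.sum_univ_two, Fin.sum_univ_three, Matrix.cons_val_zero,
    Matrix.cons_val_one, Matrix.cons_val_two, Matrix.head_cons, Matrix.tail_cons]
  nlinarith [sq_nonneg ‖c‖]

/-! ### In-plane partial derivatives and integration by parts -/

/-- **Chain rule on the plane**: for `i = 0, 1`, the partial derivative `∂ᵢ g` at `P_c y` is the
partial derivative of `g ∘ P_c` at `y` (`g` differentiable at `P_c y`). [folklore] -/
theorem pderiv_comp_plane (c : ℝ) {g : EuclideanSpace ℝ (Fin 3) → ℝ} (i : Fin 2)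
    (y : EuclideanSpace ℝ (Fin 2))
    (hg : DifferentiableAt ℝ g (WithLp.toLp 2 ![y 0, y 1, c] : EuclideanSpace ℝ (Fin 3))) :
    pderiv i (fun z : EuclideanSpace ℝ (Fin 2) =>
        g (WithLp.toLp 2 ![z 0, z 1, c] : EuclideanSpace ℝ (Fin 3))) y =
      pderiv (Fin.castSucc i) g (WithLp.toLp 2 ![y 0, y 1, c] : EuclideanSpace ℝ (Fin 3)) := by
  obtain ⟨L, hL, hLe⟩ := exists_planeCLM
  have hP := hasFDerivAt_plane c hL y
  have hcomp : HasFDerivAt (fun z : EuclideanSpace ℝ (Fin 2) =>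
      g (WithLp.toLp 2 ![z 0, z 1, c] : EuclideanSpace ℝ (Fin 3)))
      ((fderiv ℝ g (WithLp.toLp 2 ![y 0, y 1, c] : EuclideanSpace ℝ (Fin 3))).comp L) y :=
    hg.hasFDerivAt.comp y hP
  rw [pderiv_apply, pderiv_apply, hcomp.fderiv, ContinuousLinearMap.comp_apply]
  congr 1
  exact hLe i

/-- **Integration by parts on a coordinate plane**, in-plane direction `i = 0, 1`:
`∫_{Π_c} a ∂ᵢb = −∫_{Π_c} ∂ᵢa b` for differentiable `a, b` whose three products `a ∂ᵢb`, `∂ᵢa b`,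
`a b` are integrable over the plane. [folklore] -/
theorem integral_plane_mul_pderiv (c : ℝ) {a b : EuclideanSpace ℝ (Fin 3) → ℝ}
    (ha : Differentiable ℝ a) (hb : Differentiable ℝ b) (i : Fin 2)
    (h1 : Integrable fun y : EuclideanSpace ℝ (Fin 2) =>
      a (WithLp.toLp 2 ![y 0, y 1, c]) * pderiv (Fin.castSucc i) b (WithLp.toLp 2 ![y 0, y 1, c]))
    (h2 : Integrable fun y : EuclideanSpace ℝ (Fin 2) =>
      pderiv (Fin.castSucc i) a (WithLp.toLp 2 ![y 0, y 1, c]) * b (WithLp.toLp 2 ![y 0, y 1, c]))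
    (h3 : Integrable fun y : EuclideanSpace ℝ (Fin 2) =>
      a (WithLp.toLp 2 ![y 0, y 1, c]) * b (WithLp.toLp 2 ![y 0, y 1, c])) :
    ∫ y : EuclideanSpace ℝ (Fin 2),
        a (WithLp.toLp 2 ![y 0, y 1, c]) * pderiv (Fin.castSucc i) b (WithLp.toLp 2 ![y 0, y 1, c]) =
      - ∫ y : EuclideanSpace ℝ (Fin 2),
        pderiv (Fin.castSucc i) a (WithLp.toLp 2 ![y 0, y 1, c]) * b (WithLp.toLp 2 ![y 0, y 1, c]) := by
  obtain ⟨L, hL, -⟩ := exists_planeCLM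
  set A : EuclideanSpace ℝ (Fin 2) → ℝ := fun y => a (WithLp.toLp 2 ![y 0, y 1, c]) with hA
  set B : EuclideanSpace ℝ (Fin 2) → ℝ := fun y => b (WithLp.toLp 2 ![y 0, y 1, c]) with hB
  have hAd : ∀ y, DifferentiableAt ℝ A y := fun y =>
    (ha _).comp y (hasFDerivAt_plane c hL y).differentiableAt
  have hBd : ∀ y, DifferentiableAt ℝ B y := fun y =>
    (hb _).comp y (hasFDerivAt_plane c hL y).differentiableAt
  have hA' : ∀ y, fderiv ℝ A y (EuclideanSpace.single i 1) =
      pderiv (Fin.castSucc i) a (WithLp.toLp 2 ![y 0, y 1, c]) := fun y =>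
    pderiv_comp_plane c i y (ha _)
  have hB' : ∀ y, fderiv ℝ B y (EuclideanSpace.single i 1) =
      pderiv (Fin.castSucc i) b (WithLp.toLp 2 ![y 0, y 1, c]) := fun y =>
    pderiv_comp_plane c i y (hb _)
  have key := integral_mul_fderiv_eq_neg_fderiv_mul_of_integrable (μ := volume) (f := A) (g := B)
    (v := EuclideanSpace.single i 1) (by simp_rw [hA']; exact h2) (by simp_rw [hB']; exact h1)
    h3 (fun y _ => hAd y) (fun y _ => hBd y)
  simp_rw [hA', hB'] at key
  exact key

/-! ### Integrability over the plane from cubic decay -/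

/-- **A continuous function decaying like `(1 + ‖x‖)⁻³` is integrable over every coordinate
plane** (`‖y‖ ≤ ‖P_c y‖` and `dim ℝ² = 2 < 3`). [folklore] -/
theorem integrable_plane_of_decay (c : ℝ) {h : EuclideanSpace ℝ (Fin 3) → ℝ} (hc : Continuous h)
    {K : ℝ} (hK : ∀ x, |h x| ≤ K / (1 + ‖x‖) ^ 3) :
    Integrable fun y : EuclideanSpace ℝ (Fin 2) => h (WithLp.toLp 2 ![y 0, y 1, c]) := by
  have hK0 : 0 ≤ K := by
    have h0 := hK 0
    have h1 : (0 : ℝ) ≤ K / (1 + ‖(0 : EuclideanSpace ℝ (Fin 3))‖) ^ 3 := (abs_nonneg _).trans h0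
    simpa using h1
  have hint : Integrable (fun y : EuclideanSpace ℝ (Fin 2) => K * (1 + ‖y‖) ^ (-(3 : ℝ))) volume := by
    refine (integrable_one_add_norm ?_).const_mul K
    rw [finrank_euclideanSpace_fin]
    norm_num
  refine hint.mono' ((hc.comp (continuous_plane c)).aestronglyMeasurable) (Eventually.of_forall fun y => ?_)
  rw [Real.norm_eq_abs]
  refine (hK _).trans ?_
  have h1 : (1 : ℝ) + ‖y‖ ≤ 1 + ‖(WithLp.toLp 2 ![y 0, y 1, c] : EuclideanSpace ℝ (Fin 3))‖ := by
    linarith [norm_le_norm_plane c y]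
  have hy : 0 < 1 + ‖y‖ := by positivity
  have e : K * (1 + ‖y‖) ^ (-(3 : ℝ)) = K / (1 + ‖y‖) ^ 3 := by
    rw [Real.rpow_neg hy.le, div_eq_mul_inv]
    norm_num
  rw [e]
  exact div_le_div_of_nonneg_left hK0 (by positivity) (pow_le_pow_left₀ hy.le h1 3)

/-! ### Bookkeeping: bounded × decaying -/

/-- A product of a bounded and a cubically decaying function decays cubically. [folklore] -/
theorem abs_mul_le_decay {a b : EuclideanSpace ℝ (Fin 3) → ℝ} {A K : ℝ} (ha : ∀ x, |a x| ≤ A)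
    (hb : ∀ x, |b x| ≤ K / (1 + ‖x‖) ^ 3) (x : EuclideanSpace ℝ (Fin 3)) :
    |a x * b x| ≤ A * K / (1 + ‖x‖) ^ 3 := by
  have hA : 0 ≤ A := (abs_nonneg _).trans (ha x)
  rw [abs_mul, mul_div_assoc]
  exact mul_le_mul (ha x) (hb x) (abs_nonneg _) hA

/-- The same with the factors in the other order. [folklore] -/
theorem abs_mul_le_decay' {a b : EuclideanSpace ℝ (Fin 3) → ℝ} {A K : ℝ}
    (hb : ∀ x, |b x| ≤ K / (1 + ‖x‖) ^ 3) (ha : ∀ x, |a x| ≤ A) (x : EuclideanSpace ℝ (Fin 3)) :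
    |b x * a x| ≤ A * K / (1 + ‖x‖) ^ 3 := by
  rw [mul_comm]; exact abs_mul_le_decay ha hb x

/-- A cubically decaying function is bounded. [folklore] -/
theorem abs_le_of_decay {b : EuclideanSpace ℝ (Fin 3) → ℝ} {K : ℝ}
    (hb : ∀ x, |b x| ≤ K / (1 + ‖x‖) ^ 3) (x : EuclideanSpace ℝ (Fin 3)) : |b x| ≤ K := by
  have hK : 0 ≤ K := by
    by_contra hK
    push Not at hK
    have h1 : K / (1 + ‖x‖) ^ 3 < 0 := div_neg_of_neg_of_pos hK (by positivity)
    linarith [abs_nonneg (b x), hb x]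
  exact (hb x).trans (div_le_self hK (one_le_pow₀ (by linarith [norm_nonneg x])))

/-- A product of two bounded functions is bounded. [folklore] -/
theorem abs_mul_le_bdd {a b : EuclideanSpace ℝ (Fin 3) → ℝ} {A B : ℝ} (ha : ∀ x, |a x| ≤ A)
    (hb : ∀ x, |b x| ≤ B) (x : EuclideanSpace ℝ (Fin 3)) : |a x * b x| ≤ A * B := by
  rw [abs_mul]
  exact mul_le_mul (ha x) (hb x) (abs_nonneg _) ((abs_nonneg _).trans (ha x))


/-- **Bounded × decaying is integrable over the plane** (continuous factors). [folklore] -/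
theorem integrable_plane_mul (c : ℝ) {a b : EuclideanSpace ℝ (Fin 3) → ℝ} (ha : Continuous a)
    (hb : Continuous b) {A K : ℝ} (hA : ∀ x, |a x| ≤ A) (hK : ∀ x, |b x| ≤ K / (1 + ‖x‖) ^ 3) :
    Integrable fun y : EuclideanSpace ℝ (Fin 2) =>
      a (WithLp.toLp 2 ![y 0, y 1, c]) * b (WithLp.toLp 2 ![y 0, y 1, c]) :=
  integrable_plane_of_decay c (h := fun x => a x * b x) (ha.mul hb) (abs_mul_le_decay hA hK)

/-- The same with the decaying factor first. [folklore] -/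
theorem integrable_plane_mul' (c : ℝ) {a b : EuclideanSpace ℝ (Fin 3) → ℝ} (hb : Continuous b)
    (ha : Continuous a) {A K : ℝ} (hK : ∀ x, |b x| ≤ K / (1 + ‖x‖) ^ 3) (hA : ∀ x, |a x| ≤ A) :
    Integrable fun y : EuclideanSpace ℝ (Fin 2) =>
      b (WithLp.toLp 2 ![y 0, y 1, c]) * a (WithLp.toLp 2 ![y 0, y 1, c]) :=
  integrable_plane_of_decay c (h := fun x => b x * a x) (hb.mul ha) (abs_mul_le_decay' hK hA)

/-- A sum of two cubically decaying functions decays cubically. [folklore] -/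
theorem abs_add_le_decay {p q : EuclideanSpace ℝ (Fin 3) → ℝ} {K₁ K₂ : ℝ}
    (hp : ∀ x, |p x| ≤ K₁ / (1 + ‖x‖) ^ 3) (hq : ∀ x, |q x| ≤ K₂ / (1 + ‖x‖) ^ 3)
    (x : EuclideanSpace ℝ (Fin 3)) : |p x + q x| ≤ (K₁ + K₂) / (1 + ‖x‖) ^ 3 := by
  rw [add_div]
  exact (abs_add_le _ _).trans (add_le_add (hp x) (hq x))

/-- **Generic in-plane integration by parts for smooth factors**: `a` and `b` bounded, the
in-plane partials `∂ᵢa = a'`, `∂ᵢb = b'` and the product `a b` decaying cubically; then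
`∫_{Π_c} a b' = −∫_{Π_c} a' b`. [folklore] -/
theorem ibp_plane (c : ℝ) {a b a' b' : EuclideanSpace ℝ (Fin 3) → ℝ} (ha : ContDiff ℝ ∞ a)
    (hb : ContDiff ℝ ∞ b) (i : Fin 2) (hpa : pderiv (Fin.castSucc i) a = a')
    (hpb : pderiv (Fin.castSucc i) b = b') {A B K₁ K₂ K₃ : ℝ} (hA : ∀ x, |a x| ≤ A)
    (hB : ∀ x, |b x| ≤ B) (h₁ : ∀ x, |a' x| ≤ K₁ / (1 + ‖x‖) ^ 3)
    (h₂ : ∀ x, |b' x| ≤ K₂ / (1 + ‖x‖) ^ 3) (h₃ : ∀ x, |a x * b x| ≤ K₃ / (1 + ‖x‖) ^ 3) :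
    ∫ y : EuclideanSpace ℝ (Fin 2), a (WithLp.toLp 2 ![y 0, y 1, c]) * b' (WithLp.toLp 2 ![y 0, y 1, c]) =
      - ∫ y : EuclideanSpace ℝ (Fin 2),
          a' (WithLp.toLp 2 ![y 0, y 1, c]) * b (WithLp.toLp 2 ![y 0, y 1, c]) := by
  subst hpa hpb
  have hac : Continuous a := ha.continuous
  have hbc : Continuous b := hb.continuous
  have hac' : Continuous (pderiv (Fin.castSucc i) a) := continuous_pderiv ha (by simp) _
  have hbc' : Continuous (pderiv (Fin.castSucc i) b) := continuous_pderiv hb (by simp) _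
  exact integral_plane_mul_pderiv c (ha.differentiable (by simp)) (hb.differentiable (by simp)) i
    (integrable_plane_mul c hac hbc' hA h₂) (integrable_plane_mul' c hac' hbc h₁ hB)
    (integrable_plane_of_decay c (hac.mul hbc) h₃)

end FoldLaw

end Summit.NavierStokesRegularity.NavierStokesRegularity.Theorems

end
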